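import Summits.CriticalPhenomena.PercolationContinuityZ3.Theorems.PercNearOneGluingNoHeavyLowerTailIncStarBranchLemmaStep
import HarnessLib

/-!
# The R-side lemma of THEOREM C½, III: the same-branch bridge step

Support file for the Sahi programme (`--supports stmt-CriticalPhenomena-4575`, prover prim-sahi-p2 gen 19).  No definitions, no named
facts, no sorries; standard axioms.  Memo `prim-sahi-p2/PROOF-E3.md` (29h), (29k)–(29m); `RS` as in `…IncStarRSideCases`, `Θ′` as in
`…IncStarThetaDiffBranch`.  Both targets `b, c` lie (with `x₁`) behind the environment bridge `e₁ = s(x₁, v)` (near side `L ∌ s`).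
Conditioning on `e₁`: `RS(w; v; b, c) = pA′·{pA′·RS₁ + σ₀(Θ′₁ + (1−p)D₁bD₁c) + 3p(1−p)A′σ₁·D₁bD₁c}` with `RS₁ = RS(w[e₁↦0]; x₁; b, c)`,
`Θ′₁ = Θ′(w[e₁↦0]; x₁; b, c)`, `σ₀ = 1 − A′`, `σ₁ = 1 − A₁` (`IncStar.rs_sameBranch_real`, by `ring`; exact check gen19 (29l)), so
`RS ≥ 0` from the induction hypothesis `RS₁ ≥ 0` and THEOREM Θ′ (`IncStar.theta_nonneg`).  This is the case missing from rule (R) (lead g120's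
RS-lemma) — with it the R-side lemma holds on EVERY apex-forest (`IncStar.rs_nonneg`, file `…IncStarRSTree`).
-/


noncomputable section

namespace Summit.CriticalPhenomena.PercolationContinuityZ3.Theorems

namespace IncStar

open MeasureTheory Set Literature.Probability.Percolation Literature.Probability.LatticeModels EdgeInduction
open scoped Classical

variable {n : ℕ}

/-- **Arithmetic of the same-branch bridge step of `RS`.** [this work] -/
theorem rs_sameBranch_real (p A' A₁ Db Dc Dbc Xb Xc mb mc kb kc : ℝ) (hp0 : 0 ≤ p) (hp1 : p ≤ 1) (hA'0 : 0 ≤ A') (hA'1 : A' ≤ 1)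
    (hA₁1 : A₁ ≤ 1) (hDb : 0 ≤ Db) (hDc : 0 ≤ Dc)
    (IH : 0 ≤ (1 - A₁) * (Xb + Xc + Dbc) + Db * kc + Dc * kb - 3 / 2 * (1 - A₁) * (mb * Dc + mc * Db) - 3 * (1 - A₁) * Db * Dc)
    (TH : 0 ≤ Xb + Xc + Dbc - 1 / 2 * (Db * mc + Dc * mb) - Db * Dc) :
    0 ≤ (1 - ((1 - p) * A' + p * (A₁ * A'))) * (((1 - p) * 0 + p * (Xb * A'))
        + ((1 - p) * 0 + p * (Xc * A')) + ((1 - p) * 0 + p * (Dbc * A')))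
      + ((1 - p) * 0 + p * (Db * A')) * ((1 - p) * (mc * (1 - A')) + p * (mc * (1 - A') + Dc * (1 - A') + kc * A'))
      + ((1 - p) * 0 + p * (Dc * A')) * ((1 - p) * (mb * (1 - A')) + p * (mb * (1 - A') + Db * (1 - A') + kb * A'))
      - 3 / 2 * (1 - ((1 - p) * A' + p * (A₁ * A'))) * (((1 - p) * mb + p * (mb + Db * (1 - A'))) * ((1 - p) * 0 + p * (Dc * A'))
        + ((1 - p) * mc + p * (mc + Dc * (1 - A'))) * ((1 - p) * 0 + p * (Db * A')))
      - 3 * (1 - ((1 - p) * A' + p * (A₁ * A'))) * ((1 - p) * 0 + p * (Db * A')) * ((1 - p) * 0 + p * (Dc * A')) := by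
  have key : (1 - ((1 - p) * A' + p * (A₁ * A'))) * (((1 - p) * 0 + p * (Xb * A'))
        + ((1 - p) * 0 + p * (Xc * A')) + ((1 - p) * 0 + p * (Dbc * A')))
      + ((1 - p) * 0 + p * (Db * A')) * ((1 - p) * (mc * (1 - A')) + p * (mc * (1 - A') + Dc * (1 - A') + kc * A'))
      + ((1 - p) * 0 + p * (Dc * A')) * ((1 - p) * (mb * (1 - A')) + p * (mb * (1 - A') + Db * (1 - A') + kb * A'))
      - 3 / 2 * (1 - ((1 - p) * A' + p * (A₁ * A'))) * (((1 - p) * mb + p * (mb + Db * (1 - A'))) * ((1 - p) * 0 + p * (Dc * A'))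
        + ((1 - p) * mc + p * (mc + Dc * (1 - A'))) * ((1 - p) * 0 + p * (Db * A')))
      - 3 * (1 - ((1 - p) * A' + p * (A₁ * A'))) * ((1 - p) * 0 + p * (Db * A')) * ((1 - p) * 0 + p * (Dc * A'))
      = p * A' * (p * A' * ((1 - A₁) * (Xb + Xc + Dbc) + Db * kc + Dc * kb - 3 / 2 * (1 - A₁) * (mb * Dc + mc * Db) - 3 * (1 - A₁) * Db * Dc)
          + (1 - A') * ((Xb + Xc + Dbc - 1 / 2 * (Db * mc + Dc * mb) - Db * Dc) + (1 - p) * (Db * Dc)) + 3 * p * (1 - p) * A' * (1 - A₁) * (Db * Dc)) := by ring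
  rw [key]
  have h1 : 0 ≤ p * A' * ((1 - A₁) * (Xb + Xc + Dbc) + Db * kc + Dc * kb - 3 / 2 * (1 - A₁) * (mb * Dc + mc * Db) - 3 * (1 - A₁) * Db * Dc) := mul_nonneg (mul_nonneg hp0 hA'0) IH
  have h2 : 0 ≤ (1 - A') * ((Xb + Xc + Dbc - 1 / 2 * (Db * mc + Dc * mb) - Db * Dc) + (1 - p) * (Db * Dc)) :=
    mul_nonneg (by linarith) (add_nonneg TH (mul_nonneg (by linarith) (mul_nonneg hDb hDc)))
  have h3 : 0 ≤ 3 * p * (1 - p) * A' * (1 - A₁) * (Db * Dc) :=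
    mul_nonneg (mul_nonneg (mul_nonneg (mul_nonneg (mul_nonneg (by norm_num) hp0) (by linarith)) hA'0) (by linarith)) (mul_nonneg hDb hDc)
  exact mul_nonneg (mul_nonneg hp0 hA'0) (add_nonneg (add_nonneg h1 h2) h3)

/-- **R-side lemma, same-branch case (bridge step).** [this work] -/
theorem rs_bridge_step_sameBranch (w : Sym2 (Fin n) → unitInterval) (L : Set (Fin n)) {s x₁ v b c : Fin n}
    (hsL : s ∉ L) (hxL : x₁ ∈ L) (hvL : v ∉ L) (hbL : b ∈ L) (hcL : c ∈ L)
    (hcross : ∀ x y : Fin n, x ∈ L → y ∉ L → y ≠ s → s(x, y) ≠ s(x₁, v) → w s(x, y) = 0)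
    (IH : 0 ≤ (prodBernoulli (Function.update w s(x₁, v) 0)).real (openConn s x₁) * ((prodBernoulli (Function.update w s(x₁, v) 0)).real ((openConn b x₁ \ openConn s x₁) ∩ openConn s c)
            + (prodBernoulli (Function.update w s(x₁, v) 0)).real ((openConn c x₁ \ openConn s x₁) ∩ openConn s b) + (prodBernoulli (Function.update w s(x₁, v) 0)).real ((openConn b x₁ ∩ openConn c x₁) \ openConn s x₁))
        + (prodBernoulli (Function.update w s(x₁, v) 0)).real (openConn b x₁ \ openConn s x₁) * (prodBernoulli (Function.update w s(x₁, v) 0)).real (openConn s x₁ ∩ openConn s c) + (prodBernoulli (Function.update w s(x₁, v) 0)).real (openConn c x₁ \ openConn s x₁) * (prodBernoulli (Function.update w s(x₁, v) 0)).real (openConn s x₁ ∩ openConn s b)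
        - 3 / 2 * (prodBernoulli (Function.update w s(x₁, v) 0)).real (openConn s x₁) * ((prodBernoulli (Function.update w s(x₁, v) 0)).real (openConn s b) * (prodBernoulli (Function.update w s(x₁, v) 0)).real (openConn c x₁ \ openConn s x₁)
            + (prodBernoulli (Function.update w s(x₁, v) 0)).real (openConn s c) * (prodBernoulli (Function.update w s(x₁, v) 0)).real (openConn b x₁ \ openConn s x₁))
        - 3 * (prodBernoulli (Function.update w s(x₁, v) 0)).real (openConn s x₁) * (prodBernoulli (Function.update w s(x₁, v) 0)).real (openConn b x₁ \ openConn s x₁) * (prodBernoulli (Function.update w s(x₁, v) 0)).real (openConn c x₁ \ openConn s x₁))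
    (TH : 0 ≤ (prodBernoulli (Function.update w s(x₁, v) 0)).real ((openConn b x₁ \ openConn s x₁) ∩ openConn s c)
        + (prodBernoulli (Function.update w s(x₁, v) 0)).real ((openConn c x₁ \ openConn s x₁) ∩ openConn s b) + (prodBernoulli (Function.update w s(x₁, v) 0)).real ((openConn b x₁ ∩ openConn c x₁) \ openConn s x₁)
        - 1 / 2 * ((prodBernoulli (Function.update w s(x₁, v) 0)).real (openConn b x₁ \ openConn s x₁) * (prodBernoulli (Function.update w s(x₁, v) 0)).real (openConn s c)
            + (prodBernoulli (Function.update w s(x₁, v) 0)).real (openConn c x₁ \ openConn s x₁) * (prodBernoulli (Function.update w s(x₁, v) 0)).real (openConn s b))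
        - (prodBernoulli (Function.update w s(x₁, v) 0)).real (openConn b x₁ \ openConn s x₁) * (prodBernoulli (Function.update w s(x₁, v) 0)).real (openConn c x₁ \ openConn s x₁)) :
    0 ≤ (prodBernoulli w).real (openConn s v) * ((prodBernoulli w).real ((openConn b v \ openConn s v) ∩ openConn s c)
            + (prodBernoulli w).real ((openConn c v \ openConn s v) ∩ openConn s b) + (prodBernoulli w).real ((openConn b v ∩ openConn c v) \ openConn s v))
        + (prodBernoulli w).real (openConn b v \ openConn s v) * (prodBernoulli w).real (openConn s v ∩ openConn s c) + (prodBernoulli w).real (openConn c v \ openConn s v) * (prodBernoulli w).real (openConn s v ∩ openConn s b)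
        - 3 / 2 * (prodBernoulli w).real (openConn s v) * ((prodBernoulli w).real (openConn s b) * (prodBernoulli w).real (openConn c v \ openConn s v)
            + (prodBernoulli w).real (openConn s c) * (prodBernoulli w).real (openConn b v \ openConn s v))
        - 3 * (prodBernoulli w).real (openConn s v) * (prodBernoulli w).real (openConn b v \ openConn s v) * (prodBernoulli w).real (openConn c v \ openConn s v) := by
  -- names
  set e : Sym2 (Fin n) := s(x₁, v)
  set w0 := Function.update w e 0 with hw0
  set w1 := Function.update w e 1
  have hs1 : s ∈ insert s L := Set.mem_insert s L
  have hx1 : x₁ ∈ insert s L := Set.mem_insert_of_mem s hxL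
  have hb1 : b ∈ insert s L := Set.mem_insert_of_mem s hbL
  have hc1 : c ∈ insert s L := Set.mem_insert_of_mem s hcL
  -- near events and the far event
  set S : Set (BondConfig (Fin n)) := openConnIn (insert s L) s x₁
  set Bn : Set (BondConfig (Fin n)) := openConnIn (insert s L) s b
  set Cn : Set (BondConfig (Fin n)) := openConnIn (insert s L) s c
  set Fb : Set (BondConfig (Fin n)) := openConnIn (insert s L) b x₁
  set Fc : Set (BondConfig (Fin n)) := openConnIn (insert s L) c x₁
  set W' : Set (BondConfig (Fin n)) := openConnIn Lᶜ s v
  -- (0) the bridge hypothesis under `w0`, the almost-sure set, independence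
  have hw0cross : ∀ x y : Fin n, x ∈ L → y ∉ L → y ≠ s → w0 s(x, y) = 0 := by
    intro x y hx hy hys
    by_cases hxy : s(x, y) = e
    · rw [hxy, hw0, Function.update_self]
    · rw [hw0, Function.update_of_ne hxy]; exact hcross x y hx hy hys hxy
  set G : Set (BondConfig (Fin n)) := {ω | ∀ e', w0 e' = 0 → e' ∉ ω}
  have hG1 : (prodBernoulli w0).real G = 1 := real_sureClosed w0
  have hωG : ∀ ω ∈ G, ∀ x y : Fin n, x ∈ L → y ∉ L → y ≠ s → s(x, y) ∉ ω :=
    fun ω hω x y hx hy hys => hω _ (hw0cross x y hx hy hys)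
  have hm : ∀ X : Set (BondConfig (Fin n)), MeasurableSet X := fun _ => MeasurableSet.of_discrete
  have hdiff : ∀ {A B : Set (BondConfig (Fin n))} {K' : Set (Sym2 (Fin n))},
      DeterminedBy A K' → DeterminedBy B K' → DeterminedBy (A \ B) K' := by
    intro A B K' hA hB
    rw [determinedBy_iff] at hA hB ⊢
    intro ω ω' h
    rw [Set.mem_sdiff, Set.mem_sdiff, hA ω ω' h, hB ω ω' h]
  have hdn : ∀ x y : Fin n, DeterminedBy (openConnIn (insert s L) x y : Set (BondConfig (Fin n)))
      {z : Sym2 (Fin n) | ¬ z.IsDiag ∧ ∀ x ∈ z, x ∈ insert s L} := fun x y => IncStarCutVertex.determinedBy_openConnIn_offDiag _ x y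
  have hdW'c : DeterminedBy (Set.univ \ W') {z : Sym2 (Fin n) | ¬ z.IsDiag ∧ ∀ x ∈ z, x ∈ Lᶜ} :=
    hdiff (determinedBy_univ _) (IncStarCutVertex.determinedBy_openConnIn_offDiag _ s v)
  have indep : ∀ {A B : Set (BondConfig (Fin n))}, DeterminedBy A {z : Sym2 (Fin n) | ¬ z.IsDiag ∧ ∀ x ∈ z, x ∈ insert s L} →
      DeterminedBy B {z : Sym2 (Fin n) | ¬ z.IsDiag ∧ ∀ x ∈ z, x ∈ Lᶜ} →
      (prodBernoulli w0).real (A ∩ B) = (prodBernoulli w0).real A * (prodBernoulli w0).real B :=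
    fun hA hB => indep_blocks w0 L s hA hB
  -- (1) dictionary on the sure set
  have c_sv : ∀ ω ∈ G, (ω ∈ openConn s v ↔ ω ∈ W') := fun ω hω => by
    rw [bridge_conn_lr L hsL (hωG ω hω) hs1 hvL]
    exact ⟨fun h => h.2, fun h => ⟨⟨hs1, hs1, SimpleGraph.Reachable.refl _⟩, h⟩⟩
  have c_sb : ∀ ω ∈ G, (ω ∈ openConn s b ↔ ω ∈ Bn) := fun ω hω => bridge_conn_ll L hsL (hωG ω hω) hs1 hb1
  have c_sc : ∀ ω ∈ G, (ω ∈ openConn s c ↔ ω ∈ Cn) := fun ω hω => bridge_conn_ll L hsL (hωG ω hω) hs1 hc1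
  have c_bv : ∀ ω ∈ G, (ω ∈ openConn b v ↔ ω ∈ Bn ∧ ω ∈ W') := fun ω hω => by
    rw [bridge_conn_lr L hsL (hωG ω hω) hb1 hvL]
    exact ⟨fun h => ⟨openConnIn_symm' h.1, h.2⟩, fun h => ⟨openConnIn_symm' h.1, h.2⟩⟩
  have c_cv : ∀ ω ∈ G, (ω ∈ openConn c v ↔ ω ∈ Cn ∧ ω ∈ W') := fun ω hω => by
    rw [bridge_conn_lr L hsL (hωG ω hω) hc1 hvL]
    exact ⟨fun h => ⟨openConnIn_symm' h.1, h.2⟩, fun h => ⟨openConnIn_symm' h.1, h.2⟩⟩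
  have c_bx : ∀ ω ∈ G, (ω ∈ openConn b x₁ ↔ ω ∈ Fb) := fun ω hω => bridge_conn_ll L hsL (hωG ω hω) hb1 hx1
  have c_cx : ∀ ω ∈ G, (ω ∈ openConn c x₁ ↔ ω ∈ Fc) := fun ω hω => bridge_conn_ll L hsL (hωG ω hω) hc1 hx1
  have c_xb : ∀ ω ∈ G, (ω ∈ openConn x₁ b ↔ ω ∈ Fb) := fun ω hω => by
    rw [bridge_conn_ll L hsL (hωG ω hω) hx1 hb1]; exact ⟨fun h => openConnIn_symm' h, fun h => openConnIn_symm' h⟩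
  have c_xc : ∀ ω ∈ G, (ω ∈ openConn x₁ c ↔ ω ∈ Fc) := fun ω hω => by
    rw [bridge_conn_ll L hsL (hωG ω hω) hx1 hc1]; exact ⟨fun h => openConnIn_symm' h, fun h => openConnIn_symm' h⟩
  have c_sx : ∀ ω ∈ G, (ω ∈ openConn s x₁ ↔ ω ∈ S) := fun ω hω => bridge_conn_ll L hsL (hωG ω hω) hs1 hx1
  have c_xs : ∀ ω ∈ G, (ω ∈ openConn x₁ s ↔ ω ∈ S) := fun ω hω => by
    rw [bridge_conn_ll L hsL (hωG ω hω) hx1 hs1]; exact ⟨fun h => openConnIn_symm' h, fun h => openConnIn_symm' h⟩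
  -- (2) lifted events
  have l_sv : ∀ ω ∈ G, (insert e ω ∈ openConn s v ↔ ω ∈ W' ∨ ω ∈ S) := fun ω hω => by
    rw [bridge_lift_far L hsL hxL hvL hvL (hωG ω hω)]
    have hvv : ω ∈ openConnIn Lᶜ v v := ⟨hvL, hvL, SimpleGraph.Reachable.refl _⟩
    exact ⟨fun h => h.imp id fun h' => h'.1, fun h => h.imp id fun h' => ⟨h', hvv⟩⟩
  have l_sb : ∀ ω ∈ G, (insert e ω ∈ openConn s b ↔ ω ∈ Bn ∨ (ω ∈ W' ∧ ω ∈ Fb)) := fun ω hω => by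
    rw [bridge_lift_near L hsL hxL hvL hbL (hωG ω hω)]
    exact ⟨fun h => h.imp id fun h' => ⟨h'.1, openConnIn_symm' h'.2⟩, fun h => h.imp id fun h' => ⟨h'.1, openConnIn_symm' h'.2⟩⟩
  have l_sc : ∀ ω ∈ G, (insert e ω ∈ openConn s c ↔ ω ∈ Cn ∨ (ω ∈ W' ∧ ω ∈ Fc)) := fun ω hω => by
    rw [bridge_lift_near L hsL hxL hvL hcL (hωG ω hω)]
    exact ⟨fun h => h.imp id fun h' => ⟨h'.1, openConnIn_symm' h'.2⟩, fun h => h.imp id fun h' => ⟨h'.1, openConnIn_symm' h'.2⟩⟩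
  have l_bv : ∀ ω ∈ G, (insert e ω ∈ openConn b v ↔ (ω ∈ Bn ∧ ω ∈ W') ∨ ω ∈ Fb) := fun ω hω => by
    rw [insert_pair_mem_openConn_iff, c_bv ω hω, c_bx ω hω]
    have hvv : ω ∈ openConn v v := SimpleGraph.Reachable.refl _
    constructor
    · rintro (h | ⟨h1, -⟩)
      · exact Or.inl h
      · exact h1.symm
    · rintro (h | h)
      · exact Or.inl h
      · exact Or.inr ⟨Or.inl h, Or.inr hvv⟩
  have l_cv : ∀ ω ∈ G, (insert e ω ∈ openConn c v ↔ (ω ∈ Cn ∧ ω ∈ W') ∨ ω ∈ Fc) := fun ω hω => by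
    rw [insert_pair_mem_openConn_iff, c_cv ω hω, c_cx ω hω]
    have hvv : ω ∈ openConn v v := SimpleGraph.Reachable.refl _
    constructor
    · rintro (h | ⟨h1, -⟩)
      · exact Or.inl h
      · exact h1.symm
    · rintro (h | h)
      · exact Or.inl h
      · exact Or.inr ⟨Or.inl h, Or.inr hvv⟩
  -- (3) one-bond decomposition and the lift
  have ob : ∀ A : Set (BondConfig (Fin n)),
      (prodBernoulli w).real A = (1 - (w e : ℝ)) * (prodBernoulli w0).real A + (w e : ℝ) * (prodBernoulli w1).real A := by
    intro A
    have hA : DeterminedBy A (↑(Finset.univ : Finset (Sym2 (Fin n))) : Set (Sym2 (Fin n))) := by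
      rw [determinedBy_iff]
      intro ω ω' h
      rw [Finset.coe_univ, Set.inter_univ, Set.inter_univ] at h
      rw [h]
    exact prodBernoulli_real_oneBond hA w (Finset.mem_univ e)
  have lift : ∀ A : Set (BondConfig (Fin n)),
      (prodBernoulli w1).real A = (prodBernoulli w0).real ((fun ω : BondConfig (Fin n) => insert e ω) ⁻¹' A) :=
    fun A => tieLiftOne_real_one_eq w e A
  have zero_of_empty : ∀ {A : Set (BondConfig (Fin n))}, (∀ ω ∈ G, ω ∉ A) → (prodBernoulli w0).real A = 0 := by
    intro A hA
    have h : (prodBernoulli w0).real A = (prodBernoulli w0).real (∅ : Set (BondConfig (Fin n))) :=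
      real_congr_of_sure hG1 fun ω hω => ⟨fun h => (hA ω hω h).elim, fun h => (Set.notMem_empty _ h).elim⟩
    rw [h, measureReal_empty]
  -- (4) moments under `w0`
  have a0 : (prodBernoulli w0).real (openConn s v)ᶜ = (prodBernoulli w0).real (Set.univ \ W') :=
    real_congr_of_sure hG1 fun ω hω => by
      rw [Set.mem_compl_iff, c_sv ω hω, Set.mem_sdiff]; exact ⟨fun h => ⟨Set.mem_univ _, h⟩, fun h => h.2⟩
  have db0 : (prodBernoulli w0).real (openConn b v \ openConn s v) = 0 :=
    zero_of_empty fun ω hω h => by rw [Set.mem_sdiff, c_bv ω hω, c_sv ω hω] at h; exact h.2 h.1.2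
  have dc0 : (prodBernoulli w0).real (openConn c v \ openConn s v) = 0 :=
    zero_of_empty fun ω hω h => by rw [Set.mem_sdiff, c_cv ω hω, c_sv ω hω] at h; exact h.2 h.1.2
  have dbc0 : (prodBernoulli w0).real ((openConn b v ∩ openConn c v) \ openConn s v) = 0 :=
    zero_of_empty fun ω hω h => by
      rw [Set.mem_sdiff, Set.mem_inter_iff, c_bv ω hω, c_sv ω hω] at h; exact h.2 h.1.1.2
  have xb0 : (prodBernoulli w0).real ((openConn b v \ openConn s v) ∩ openConn s c) = 0 :=
    zero_of_empty fun ω hω h => by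
      rw [Set.mem_inter_iff, Set.mem_sdiff, c_bv ω hω, c_sv ω hω] at h; exact h.1.2 h.1.1.2
  have xc0 : (prodBernoulli w0).real ((openConn c v \ openConn s v) ∩ openConn s b) = 0 :=
    zero_of_empty fun ω hω h => by
      rw [Set.mem_inter_iff, Set.mem_sdiff, c_cv ω hω, c_sv ω hω] at h; exact h.1.2 h.1.1.2
  -- (5) moments under `w1`
  have a1 : (prodBernoulli w1).real (openConn s v)ᶜ
      = (prodBernoulli w0).real (Set.univ \ S) * (prodBernoulli w0).real (Set.univ \ W') := by
    rw [lift, ← indep (hdiff (determinedBy_univ _) (hdn s x₁)) hdW'c]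
    refine real_congr_of_sure hG1 fun ω hω => ?_
    simp only [Set.preimage_compl, Set.mem_compl_iff, Set.mem_preimage, l_sv ω hω, Set.mem_inter_iff, Set.mem_sdiff,
      Set.mem_univ, true_and]
    tauto
  have db1 : (prodBernoulli w1).real (openConn b v \ openConn s v)
      = (prodBernoulli w0).real (Fb \ S) * (prodBernoulli w0).real (Set.univ \ W') := by
    rw [lift, ← indep (hdiff (hdn b x₁) (hdn s x₁)) hdW'c]
    refine real_congr_of_sure hG1 fun ω hω => ?_
    simp only [Set.preimage_sdiff, Set.mem_sdiff, Set.mem_preimage, l_bv ω hω, l_sv ω hω, Set.mem_inter_iff, Set.mem_univ,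
      true_and]
    tauto
  have dc1 : (prodBernoulli w1).real (openConn c v \ openConn s v)
      = (prodBernoulli w0).real (Fc \ S) * (prodBernoulli w0).real (Set.univ \ W') := by
    rw [lift, ← indep (hdiff (hdn c x₁) (hdn s x₁)) hdW'c]
    refine real_congr_of_sure hG1 fun ω hω => ?_
    simp only [Set.preimage_sdiff, Set.mem_sdiff, Set.mem_preimage, l_cv ω hω, l_sv ω hω, Set.mem_inter_iff, Set.mem_univ,
      true_and]
    tauto
  have dbc1 : (prodBernoulli w1).real ((openConn b v ∩ openConn c v) \ openConn s v)
      = (prodBernoulli w0).real ((Fb ∩ Fc) \ S) * (prodBernoulli w0).real (Set.univ \ W') := by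
    rw [lift, ← indep (hdiff ((hdn b x₁).inter (hdn c x₁)) (hdn s x₁)) hdW'c]
    refine real_congr_of_sure hG1 fun ω hω => ?_
    simp only [Set.preimage_sdiff, Set.preimage_inter, Set.mem_sdiff, Set.mem_inter_iff, Set.mem_preimage, l_bv ω hω, l_cv ω hω,
      l_sv ω hω, Set.mem_univ, true_and]
    tauto
  have xb1 : (prodBernoulli w1).real ((openConn b v \ openConn s v) ∩ openConn s c)
      = (prodBernoulli w0).real ((Fb \ S) ∩ Cn) * (prodBernoulli w0).real (Set.univ \ W') := by
    rw [lift, ← indep ((hdiff (hdn b x₁) (hdn s x₁)).inter (hdn s c)) hdW'c]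
    refine real_congr_of_sure hG1 fun ω hω => ?_
    simp only [Set.preimage_sdiff, Set.preimage_inter, Set.mem_sdiff, Set.mem_inter_iff, Set.mem_preimage, l_bv ω hω, l_sc ω hω,
      l_sv ω hω, Set.mem_univ, true_and]
    tauto
  have xc1 : (prodBernoulli w1).real ((openConn c v \ openConn s v) ∩ openConn s b)
      = (prodBernoulli w0).real ((Fc \ S) ∩ Bn) * (prodBernoulli w0).real (Set.univ \ W') := by
    rw [lift, ← indep ((hdiff (hdn c x₁) (hdn s x₁)).inter (hdn s b)) hdW'c]
    refine real_congr_of_sure hG1 fun ω hω => ?_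
    simp only [Set.preimage_sdiff, Set.preimage_inter, Set.mem_sdiff, Set.mem_inter_iff, Set.mem_preimage, l_cv ω hω, l_sb ω hω,
      l_sv ω hω, Set.mem_univ, true_and]
    tauto
  have hW'c : (prodBernoulli w0).real W' = 1 - (prodBernoulli w0).real (Set.univ \ W') := by
    rw [← Set.compl_eq_univ_sdiff, probReal_compl_eq_one_sub (hm _)]; ring
  have hBFS : ∀ ω, ω ∈ Bn → ω ∈ Fb → ω ∈ S := fun ω hB hF => PlanarDuality.openConnIn_trans hB hF
  have hFSB : ∀ ω, ω ∈ Fb → ω ∈ S → ω ∈ Bn := fun ω hF hS => PlanarDuality.openConnIn_trans hS (openConnIn_symm' hF)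
  have hCFS : ∀ ω, ω ∈ Cn → ω ∈ Fc → ω ∈ S := fun ω hC hF => PlanarDuality.openConnIn_trans hC hF
  have hFSC : ∀ ω, ω ∈ Fc → ω ∈ S → ω ∈ Cn := fun ω hF hS => PlanarDuality.openConnIn_trans hS (openConnIn_symm' hF)
  have mb0 : (prodBernoulli w0).real (openConn s b) = (prodBernoulli w0).real Bn := real_congr_of_sure hG1 c_sb
  have mc0 : (prodBernoulli w0).real (openConn s c) = (prodBernoulli w0).real Cn := real_congr_of_sure hG1 c_sc
  have mb1 : (prodBernoulli w1).real (openConn s b) = (prodBernoulli w0).real Bn + (prodBernoulli w0).real (Fb \ S) * (prodBernoulli w0).real W' := by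
    rw [lift, ← indep (hdiff (hdn b x₁) (hdn s x₁)) (IncStarCutVertex.determinedBy_openConnIn_offDiag _ s v), ← measureReal_union ?_ (hm _)]
    · refine real_congr_of_sure hG1 fun ω hω => ?_
      simp only [Set.mem_preimage, l_sb ω hω, Set.mem_union, Set.mem_inter_iff, Set.mem_sdiff]
      constructor
      · rintro (hB | ⟨hW, hF⟩)
        · exact Or.inl hB
        · by_cases hB : ω ∈ Bn
          · exact Or.inl hB
          · exact Or.inr ⟨⟨hF, fun hS => hB (hFSB ω hF hS)⟩, hW⟩
      · rintro (hB | ⟨⟨hF, -⟩, hW⟩)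
        · exact Or.inl hB
        · exact Or.inr ⟨hW, hF⟩
    · exact Set.disjoint_left.2 fun ω hB h2 => h2.1.2 (hBFS ω hB h2.1.1)
  have mc1 : (prodBernoulli w1).real (openConn s c) = (prodBernoulli w0).real Cn + (prodBernoulli w0).real (Fc \ S) * (prodBernoulli w0).real W' := by
    rw [lift, ← indep (hdiff (hdn c x₁) (hdn s x₁)) (IncStarCutVertex.determinedBy_openConnIn_offDiag _ s v), ← measureReal_union ?_ (hm _)]
    · refine real_congr_of_sure hG1 fun ω hω => ?_
      simp only [Set.mem_preimage, l_sc ω hω, Set.mem_union, Set.mem_inter_iff, Set.mem_sdiff]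
      constructor
      · rintro (hC | ⟨hW, hF⟩)
        · exact Or.inl hC
        · by_cases hC : ω ∈ Cn
          · exact Or.inl hC
          · exact Or.inr ⟨⟨hF, fun hS => hC (hFSC ω hF hS)⟩, hW⟩
      · rintro (hC | ⟨⟨hF, -⟩, hW⟩)
        · exact Or.inl hC
        · exact Or.inr ⟨hW, hF⟩
    · exact Set.disjoint_left.2 fun ω hC h2 => h2.1.2 (hCFS ω hC h2.1.1)
  have hσ : (prodBernoulli w).real (openConn s v) = 1 - (prodBernoulli w).real (openConn s v)ᶜ := by
    rw [probReal_compl_eq_one_sub (hm _)]; ring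
  have yb0 : (prodBernoulli w0).real (openConn s v ∩ openConn s b) = (prodBernoulli w0).real Bn * (prodBernoulli w0).real W' := by
    rw [← indep (hdn s b) (IncStarCutVertex.determinedBy_openConnIn_offDiag _ s v)]
    exact real_congr_of_sure hG1 fun ω hω => by rw [Set.mem_inter_iff, Set.mem_inter_iff, c_sv ω hω, c_sb ω hω]; tauto
  have yc0 : (prodBernoulli w0).real (openConn s v ∩ openConn s c) = (prodBernoulli w0).real Cn * (prodBernoulli w0).real W' := by
    rw [← indep (hdn s c) (IncStarCutVertex.determinedBy_openConnIn_offDiag _ s v)]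
    exact real_congr_of_sure hG1 fun ω hω => by rw [Set.mem_inter_iff, Set.mem_inter_iff, c_sv ω hω, c_sc ω hω]; tauto
  have yb1 : (prodBernoulli w1).real (openConn s v ∩ openConn s b)
      = (prodBernoulli w0).real Bn * (prodBernoulli w0).real W' + (prodBernoulli w0).real (Fb \ S) * (prodBernoulli w0).real W'
        + (prodBernoulli w0).real (Bn ∩ S) * (prodBernoulli w0).real (Set.univ \ W') := by
    rw [lift, ← indep (hdn s b) (IncStarCutVertex.determinedBy_openConnIn_offDiag _ s v),
      ← indep (hdiff (hdn b x₁) (hdn s x₁)) (IncStarCutVertex.determinedBy_openConnIn_offDiag _ s v), ← indep ((hdn s b).inter (hdn s x₁)) hdW'c,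
      ← measureReal_union ?_ (hm _), ← measureReal_union ?_ (hm _)]
    · refine real_congr_of_sure hG1 fun ω hω => ?_
      simp only [Set.preimage_inter, Set.mem_inter_iff, Set.mem_preimage, l_sv ω hω, l_sb ω hω, Set.mem_union, Set.mem_sdiff, Set.mem_univ, true_and]
      constructor
      · rintro ⟨hW | hS, hB | ⟨hW', hF⟩⟩
        · exact Or.inl (Or.inl ⟨hB, hW⟩)
        · by_cases hB : ω ∈ Bn
          · exact Or.inl (Or.inl ⟨hB, hW⟩)
          · exact Or.inl (Or.inr ⟨⟨hF, fun hS => hB (hFSB ω hF hS)⟩, hW'⟩)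
        · by_cases hW : ω ∈ W'
          · exact Or.inl (Or.inl ⟨hB, hW⟩)
          · exact Or.inr ⟨⟨hB, hS⟩, hW⟩
        · exact Or.inl (Or.inl ⟨hFSB ω hF hS, hW'⟩)
      · rintro ((⟨hB, hW⟩ | ⟨⟨hF, -⟩, hW⟩) | ⟨⟨hB, hS⟩, -⟩)
        · exact ⟨Or.inl hW, Or.inl hB⟩
        · exact ⟨Or.inl hW, Or.inr ⟨hW, hF⟩⟩
        · exact ⟨Or.inr hS, Or.inl hB⟩
    · exact Set.disjoint_left.2 fun ω h1 h2 => by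
        rcases h1 with ⟨-, hW⟩ | ⟨-, hW⟩ <;> exact h2.2.2 hW
    · exact Set.disjoint_left.2 fun ω h1 h2 => h2.1.2 (hBFS ω h1.1 h2.1.1)
  have yc1 : (prodBernoulli w1).real (openConn s v ∩ openConn s c)
      = (prodBernoulli w0).real Cn * (prodBernoulli w0).real W' + (prodBernoulli w0).real (Fc \ S) * (prodBernoulli w0).real W'
        + (prodBernoulli w0).real (Cn ∩ S) * (prodBernoulli w0).real (Set.univ \ W') := by
    rw [lift, ← indep (hdn s c) (IncStarCutVertex.determinedBy_openConnIn_offDiag _ s v),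
      ← indep (hdiff (hdn c x₁) (hdn s x₁)) (IncStarCutVertex.determinedBy_openConnIn_offDiag _ s v), ← indep ((hdn s c).inter (hdn s x₁)) hdW'c,
      ← measureReal_union ?_ (hm _), ← measureReal_union ?_ (hm _)]
    · refine real_congr_of_sure hG1 fun ω hω => ?_
      simp only [Set.preimage_inter, Set.mem_inter_iff, Set.mem_preimage, l_sv ω hω, l_sc ω hω, Set.mem_union, Set.mem_sdiff, Set.mem_univ, true_and]
      constructor
      · rintro ⟨hW | hS, hC | ⟨hW', hF⟩⟩
        · exact Or.inl (Or.inl ⟨hC, hW⟩)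
        · by_cases hC : ω ∈ Cn
          · exact Or.inl (Or.inl ⟨hC, hW⟩)
          · exact Or.inl (Or.inr ⟨⟨hF, fun hS => hC (hFSC ω hF hS)⟩, hW'⟩)
        · by_cases hW : ω ∈ W'
          · exact Or.inl (Or.inl ⟨hC, hW⟩)
          · exact Or.inr ⟨⟨hC, hS⟩, hW⟩
        · exact Or.inl (Or.inl ⟨hFSC ω hF hS, hW'⟩)
      · rintro ((⟨hC, hW⟩ | ⟨⟨hF, -⟩, hW⟩) | ⟨⟨hC, hS⟩, -⟩)
        · exact ⟨Or.inl hW, Or.inl hC⟩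
        · exact ⟨Or.inl hW, Or.inr ⟨hW, hF⟩⟩
        · exact ⟨Or.inr hS, Or.inl hC⟩
    · exact Set.disjoint_left.2 fun ω h1 h2 => by
        rcases h1 with ⟨-, hW⟩ | ⟨-, hW⟩ <;> exact h2.2.2 hW
    · exact Set.disjoint_left.2 fun ω h1 h2 => h2.1.2 (hCFS ω h1.1 h2.1.1)
  -- (6) the sub-instance quantities in block form
  have eA₁ : (prodBernoulli w0).real (openConn s x₁)ᶜ = (prodBernoulli w0).real (Set.univ \ S) :=
    real_congr_of_sure hG1 fun ω hω => by
      rw [Set.mem_compl_iff, c_sx ω hω, Set.mem_sdiff]; exact ⟨fun h => ⟨Set.mem_univ _, h⟩, fun h => h.2⟩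
  have eDb : (prodBernoulli w0).real (openConn b x₁ \ openConn s x₁) = (prodBernoulli w0).real (Fb \ S) :=
    real_congr_of_sure hG1 fun ω hω => by rw [Set.mem_sdiff, Set.mem_sdiff, c_bx ω hω, c_sx ω hω]
  have eDc : (prodBernoulli w0).real (openConn c x₁ \ openConn s x₁) = (prodBernoulli w0).real (Fc \ S) :=
    real_congr_of_sure hG1 fun ω hω => by rw [Set.mem_sdiff, Set.mem_sdiff, c_cx ω hω, c_sx ω hω]
  have eDbc : (prodBernoulli w0).real ((openConn b x₁ ∩ openConn c x₁) \ openConn s x₁) = (prodBernoulli w0).real ((Fb ∩ Fc) \ S) :=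
    real_congr_of_sure hG1 fun ω hω => by
      rw [Set.mem_sdiff, Set.mem_sdiff, Set.mem_inter_iff, Set.mem_inter_iff, c_bx ω hω, c_cx ω hω, c_sx ω hω]
  have eXb : (prodBernoulli w0).real ((openConn b x₁ \ openConn s x₁) ∩ openConn s c) = (prodBernoulli w0).real ((Fb \ S) ∩ Cn) :=
    real_congr_of_sure hG1 fun ω hω => by
      rw [Set.mem_inter_iff, Set.mem_inter_iff, Set.mem_sdiff, Set.mem_sdiff, c_bx ω hω, c_sx ω hω, c_sc ω hω]
  have eXc : (prodBernoulli w0).real ((openConn c x₁ \ openConn s x₁) ∩ openConn s b) = (prodBernoulli w0).real ((Fc \ S) ∩ Bn) :=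
    real_congr_of_sure hG1 fun ω hω => by
      rw [Set.mem_inter_iff, Set.mem_inter_iff, Set.mem_sdiff, Set.mem_sdiff, c_cx ω hω, c_sx ω hω, c_sb ω hω]
  have emb : (prodBernoulli w0).real (openConn s b) = (prodBernoulli w0).real Bn := mb0
  have emc : (prodBernoulli w0).real (openConn s c) = (prodBernoulli w0).real Cn := mc0
  have hS1 : (prodBernoulli w0).real (openConn s x₁) = 1 - (prodBernoulli w0).real (openConn s x₁)ᶜ := by
    rw [probReal_compl_eq_one_sub (hm _)]; ring
  have eyb : (prodBernoulli w0).real (openConn s x₁ ∩ openConn s b) = (prodBernoulli w0).real (Bn ∩ S) :=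
    real_congr_of_sure hG1 fun ω hω => by rw [Set.mem_inter_iff, Set.mem_inter_iff, c_sx ω hω, c_sb ω hω]; tauto
  have eyc : (prodBernoulli w0).real (openConn s x₁ ∩ openConn s c) = (prodBernoulli w0).real (Cn ∩ S) :=
    real_congr_of_sure hG1 fun ω hω => by rw [Set.mem_inter_iff, Set.mem_inter_iff, c_sx ω hω, c_sc ω hω]; tauto
  -- sign facts
  have hp0 : (0 : ℝ) ≤ w e := (w e).2.1
  have hp1 : (w e : ℝ) ≤ 1 := (w e).2.2
  -- (7) assemble
  have IH' := IH
  rw [hS1, eA₁, eDb, eDc, eDbc, eXb, eXc, eyb, eyc, emb, emc] at IH'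
  have TH' := TH
  rw [eDb, eDc, eDbc, eXb, eXc, emb, emc] at TH'
  rw [hσ, ob (openConn s v)ᶜ, ob (openConn b v \ openConn s v), ob (openConn c v \ openConn s v),
    ob ((openConn b v ∩ openConn c v) \ openConn s v), ob ((openConn b v \ openConn s v) ∩ openConn s c),
    ob ((openConn c v \ openConn s v) ∩ openConn s b), ob (openConn s v ∩ openConn s b), ob (openConn s v ∩ openConn s c),
    ob (openConn s b), ob (openConn s c),
    a0, a1, db0, db1, dc0, dc1, dbc0, dbc1, xb0, xb1, xc0, xc1, yb0, yb1, yc0, yc1, mb0, mb1, mc0, mc1, hW'c]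
  have key := rs_sameBranch_real (w e) ((prodBernoulli w0).real (Set.univ \ W')) ((prodBernoulli w0).real (Set.univ \ S))
    ((prodBernoulli w0).real (Fb \ S)) ((prodBernoulli w0).real (Fc \ S)) ((prodBernoulli w0).real ((Fb ∩ Fc) \ S))
    ((prodBernoulli w0).real ((Fb \ S) ∩ Cn)) ((prodBernoulli w0).real ((Fc \ S) ∩ Bn))
    ((prodBernoulli w0).real Bn) ((prodBernoulli w0).real Cn) ((prodBernoulli w0).real (Bn ∩ S)) ((prodBernoulli w0).real (Cn ∩ S))
    hp0 hp1 measureReal_nonneg measureReal_le_one measureReal_le_one measureReal_nonneg measureReal_nonneg IH' TH'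
  linarith [key]

end IncStar

end Summit.CriticalPhenomena.PercolationContinuityZ3.Theorems
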